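import Summits.BirchSwinnertonDyer.BirchSwinnertonDyer.Theorems.PrintCf2RubinValueTwoRowTwoRelCoresKummer
import Literature.NumberTheory.ComplexMultiplication.EllipticUnits.ImaginaryQuadraticMainConjectureCarriersCores
import Literature.NumberTheory.GaloisRepresentations.ContinuousCorestrictionResNormal
import HarnessLib

/-!
# M-LINE-PIN / (α3) ROW 2, FILE 6b: `res ∘ cor` IS THE NORM on ty2's level groups — if `cor_{F′→F} c = 0` then `Σ_{δ ∈ Gal(F′/F)} δ·c = 0`

Cell `bsd-print-cf2`, WIDTH seat `bsd-line-cf2-p1-w6` g9 (prover-bsd-line-cf2-p1-w6-g9-0), successor of g8 on (α3) ROW 2 of the JLK road on the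
DECIDING child stmt-BirchSwinnertonDyer-24721 `PrintCf2RubinValueTwo.MainConjClauseAtSplitTwoQuadDA` (memo `HOME/bsd-line-cf2-p1-w6/ROW2-RHO3-SPEC-w6g9.md`
§1 (K-b); successor item ρ3, kernel half); `--supports` that item (helper, Theses-free). HONEST FRAMING: transport of the tree's
`resLe_coresLe_eq_sum_conjMap` (NSW (1.5.7), normal case) into ty2's currency `levelCoh / relCores / levelConj`; nothing here closes the crux or a
registered stub; no summit statement is proved by this seat; BSD is not proved by any of this. THEOREMS ONLY (no definition, no named fact, no
instance, no `sorry`).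

WHAT. For open `U′ ≤ U ≤ Γ_K` with `U′ ⊴ Γ_K` and `N_S ≤ U′`, and any system `t` of representatives of `U/U′`:
* `resLe_relCores_eq_sum_levelConj` — `res_{U′} (cor_{U′→U} c) = Σ_y (t y)·c` on `H¹(G_S(F′), μ_{p^k} ⊗ θ)` (`relCores = coresLe` in degree one,
  (G2) `relCores_one_eq_coresLe`; the representatives are read in `U_S/U′_S` through g8's `exists_quotientEquiv_imGS`);
* **`sum_levelConj_eq_zero_of_relCores_eq_zero`** — hence `cor_{U′→U} c = 0 ⟹ Σ_y (t y)·c = 0`: the form the kernel half of ROW 2 consumes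
  ((R2-5): with `U′ = Gal(K̄/F_n)`, `U = Gal(K̄/K̃_n)`, the twisted conjugation law FILE 3h turns the sum into `κ(∏_δ (δu)^{θ′(δ)})`).

presearch: NSW I §5 (1.5.6)–(1.5.7) (res∘cor = norm for normal subgroups) — tree `ContinuousCorestrictionResNormal`. beyond-print theorem: no.

References: J. Neukirch, A. Schmidt, K. Wingberg, *Cohomology of Number Fields* I §5 (1.5.6)–(1.5.7); J.-P. Serre, *Local Fields* VII §5–7.
-/

noncomputable section

open scoped Classical

-- the summit namespace `Summit.BirchSwinnertonDyer.BirchSwinnertonDyer` repeats the problem name by design (D-0017)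
set_option linter.dupNamespace false
set_option autoImplicit false

open scoped NumberField
open Field IsDedekindDomain
open Literature.NumberTheory.GaloisRepresentations Literature.NumberTheory.GaloisRepresentations.DiscreteGaloisModule
open Literature.NumberTheory.ComplexMultiplication.EllipticUnits.JohnsonLeungKings2011

namespace Summit.BirchSwinnertonDyer.BirchSwinnertonDyer.Theorems.PrintCf2.RowTwo

variable {K : Type} [Field K] [NumberField K] (p : ℕ) [Fact p.Prime] (S : Set (HeightOneSpectrum (𝓞 K)))
  (θ : absoluteGaloisGroup K →ₜ* ℤ_[p]ˣ) (k : ℕ) {U U' : Subgroup (absoluteGaloisGroup K)} [U'.Normal]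

/-- **`res_{U′} ∘ cor_{U′→U} = Σ_{y ∈ U/U′} (t y)·`** on `H¹(G_S(F′), μ_{p^k} ⊗ θ)` for `U′ ⊴ Γ_K` open, `N_S ≤ U′ ≤ U` open, `t` any system of
representatives of `U/U′` (read in `U_S/U′_S`). [cite: NeukirchSchmidtWingberg2008, I §5 (1.5.6)–(1.5.7)] -/
theorem resLe_relCores_eq_sum_levelConj (h : U' ≤ U) (hU : IsOpen (U : Set (absoluteGaloisGroup K)))
    (hU' : IsOpen (U' : Set (absoluteGaloisGroup K))) (hN : ramificationSubgroup K S ≤ U')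
    [Fintype (U ⧸ U'.subgroupOf U)] {t : U ⧸ U'.subgroupOf U → U} (ht : ∀ y, (t y : U ⧸ U'.subgroupOf U) = y) (c : levelCoh p S θ U' k 1) :
    resLe (coeffGS p S θ k).toTopRep (imGS_le_of_le S h) 1 (relCores p S θ h hU hU' k 1 c) =
      ∑ y, levelConj p S θ U' k 1 ((t y : U) : absoluteGaloisGroup K) c := by
  classical
  haveI : TotallyDisconnectedSpace (GaloisGroupUnramifiedOutside K S) :=
    Literature.GroupTheory.ProfiniteSubquotients.totallyDisconnectedSpace_quotient
      (ramificationSubgroup K S) (ramificationSubgroup_isClosed K S)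
  haveI := normal_imGS S U'
  haveI : CompactSpace (imGS S U) := isCompact_iff_compactSpace.mp (isClosed_imGS' S hU).isCompact
  haveI : ((imGS S U').subgroupOf (imGS S U)).FiniteIndex := by
    haveI := finiteIndex_imGS' S hU'
    infer_instance
  -- representatives of `U_S/U'_S` read off `t`
  obtain ⟨e, he⟩ := exists_quotientEquiv_imGS S (U := U) hN
  let F : U → imGS S U := fun a ↦ ⟨toUnramifiedQuot K S a, Subgroup.mem_map_of_mem _ a.2⟩
  letI : Fintype (↥(imGS S U) ⧸ (imGS S U').subgroupOf (imGS S U)) := Fintype.ofEquiv _ e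
  let s : ↥(imGS S U) ⧸ (imGS S U').subgroupOf (imGS S U) → imGS S U := fun z ↦ F (t (e.symm z))
  have hs : ∀ z, (s z : ↥(imGS S U) ⧸ (imGS S U').subgroupOf (imGS S U)) = z := fun z ↦ by
    change ((F (t (e.symm z))) : ↥(imGS S U) ⧸ (imGS S U').subgroupOf (imGS S U)) = z
    rw [← he, ht, Equiv.apply_symm_apply]
  have hsy : ∀ y, (s (e y) : GaloisGroupUnramifiedOutside K S) = toUnramifiedQuot K S ((t y : U) : absoluteGaloisGroup K) := fun y ↦ by
    change toUnramifiedQuot K S ((t (e.symm (e y)) : U) : absoluteGaloisGroup K) = _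
    rw [Equiv.symm_apply_apply]
  rw [relCores_one_eq_coresLe p S θ h hU hU' k c,
    resLe_coresLe_eq_sum_conjMap (coeffGS p S θ k).toTopRep (imGS_le_of_le S h) (isOpen_imGS_of_isOpen S hU') hs c]
  -- reindex along `e` and unfold `conjMap` to `levelConj`
  rw [← Equiv.sum_comp e]
  refine Finset.sum_congr rfl fun y _ ↦ ?_
  rw [levelConj_apply]
  exact congrArg (fun a : GaloisGroupUnramifiedOutside K S ↦ (conjMap (coeffGS p S θ k).toTopRep (imGS S U') a 1).hom c) (hsy y)

/-- **`cor_{U′→U} c = 0 ⟹ Σ_{y ∈ U/U′} (t y)·c = 0`** (`res ∘ cor` is the norm). The kernel half of ROW 2 applies this with `U′ = Gal(K̄/F_n) ⊴ Γ_K`,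
`U = Gal(K̄/K̃_n)`, `c = κ_k(u′)`. [cite: NeukirchSchmidtWingberg2008, I §5 (1.5.6)–(1.5.7)] -/
theorem sum_levelConj_eq_zero_of_relCores_eq_zero (h : U' ≤ U) (hU : IsOpen (U : Set (absoluteGaloisGroup K)))
    (hU' : IsOpen (U' : Set (absoluteGaloisGroup K))) (hN : ramificationSubgroup K S ≤ U')
    [Fintype (U ⧸ U'.subgroupOf U)] {t : U ⧸ U'.subgroupOf U → U} (ht : ∀ y, (t y : U ⧸ U'.subgroupOf U) = y) {c : levelCoh p S θ U' k 1}
    (hc : relCores p S θ h hU hU' k 1 c = 0) :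
    ∑ y, levelConj p S θ U' k 1 ((t y : U) : absoluteGaloisGroup K) c = 0 := by
  have h1 := resLe_relCores_eq_sum_levelConj p S θ k h hU hU' hN ht c
  rw [hc] at h1
  rw [← h1]
  exact map_zero _

end Summit.BirchSwinnertonDyer.BirchSwinnertonDyer.Theorems.PrintCf2.RowTwo

end
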